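import Summits.BirchSwinnertonDyer.Rank1Residual.X11b.Three.GoodReductionSubgroupCuspPadic
import Literature.NumberTheory.EllipticCurves.RootNumberLocalConstancyProofs
import HarnessLib

/-!
# X11b at `p = 3` (team N8/O2), JET3-KUMMER: the `K_v`-minimal equation stays minimal over an
# UNRAMIFIED layer at every place of residue characteristic `≠ 2, 3` (Silverman, *AEC* VII.5.4 (a)
# with VII.1 Remark 1.1) — the residual binder R7′ discharged away from `2, 3`

HONEST FRAMING (cell `b2b-bsdres`, run/shared/lean/b2b/bsd-rank1-residual/, verbatim in every
file): the goal of the cell is to DELETE the COMBINATION-SHAPED residual classes of the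
Birch–Swinnerton-Dyer formula for ALL analytic-rank `≤ 1` elliptic curves over `ℚ` — "full BSD
formula for every rank `≤ 1` curve in class `C`" assembled STRICTLY from published theorems — so
that the rank-`≤ 1` remainder becomes exactly the CONSTRUCTION-SHAPED classes, which are TYPED
(missing-input `Prop`s), NOT attempted. This is not "finishing BSD". Team N8/O2 = `x11b3`, seat
`b2b-bsdres-x11b3-p4` (provider of record at additive places, LEAD DEAL #7 R7-28 / R7-35), S15
part 16 (offer S15 (vii)). THEOREMS ONLY: no definition, no named fact, no `sorry`; nothing is
booked; `JET@p|N` is NOT discharged.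

## What

The (α)-provider files at ADDITIVE places (parts 14/15, `GoodReductionSubgroupCuspPresentation`,
`GoodReductionSubgroupCuspPadic`, and p2's `AdditivePlaceKummer`) carry the instance binder
`[(X ⊗ L).IsMinimal R]` (R7′ of `S15-INTERFACE.md` §4): the `K_v`-minimal equation of `E` should
stay minimal over the valuation ring `R` of the unramified layer `L_w = K[c]_w ⊇ K_v = F`. At a
MULTIPLICATIVE place this is part 3 (`isMinimal_baseChange_of_hasMultiplicativeReduction`, *AEC*
VII.5.4 (b)); at an additive place it was accepted as a LABELLED residual (lead R7-28 (2): "Tate's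
algorithm under unramified base change"). Away from residue characteristics `2, 3` no Tate's
algorithm is needed: Silverman, *AEC* VII.1 Remark 1.1 — "if char `k ≠ 2, 3`, the equation is
minimal if and only if `v(Δ) < 12` or `v(c₄) < 4`" — and BOTH halves are in the tree over an
abstract discrete valuation ring (`WeierstrassCurve.not_Δ_mem_pow_and_c₄_mem_pow_of_isMinimal`,
`WeierstrassCurve.isMinimal_of_not_Δ_mem_pow_and_c₄_mem_pow`, file
`Literature/NumberTheory/EllipticCurves/RootNumberLocalConstancyProofs.lean`). What remains is the
transfer along an UNRAMIFIED local extension `R₀ → R` — the residual binder R5 verbatim (a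
uniformiser `ϖ` of `R` comes from `F`: `hπ : algebraMap F L π = algebraMap R L ϖ`):

* §1 `exists_irreducible_algebraMap_eq` (the uniformiser of `R` is the image of a uniformiser
  `π₀` of `R₀`: `R ∩ F = R₀` by part 1's `algebraMap_mem_range_iff`, and a local homomorphism
  reflects irreducibility), `addVal_algebraMap_eq` (`v_R (ι r) = v_{R₀} (r)`, i.e. `e = 1`),
  `algebraMap_mem_maximalIdeal_pow_iff` (`ι r ∈ 𝔪_Rⁿ ↔ r ∈ 𝔪_{R₀}ⁿ`);
* §2 **`isMinimal_baseChange_of_isUnit_two_three`** — *AEC* VII.5.4 (a) at residue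
  characteristic `∉ {2, 3}`: `(X ⊗ F).IsMinimal R₀`, `2, 3 ∈ R₀ˣ`, R5 `⇒ (X ⊗ L).IsMinimal R` (the
  integral model over `R` is the one over `R₀` mapped along `ι`, part 1
  `integralModel_baseChange_eq_map`, so `Δ ∈ 𝔪¹² ∧ c₄ ∈ 𝔪⁴` holds over `R` iff over `R₀`; a
  singular equation `Δ = 0` is minimal in Mathlib's sense for free);
  `hasAdditiveReduction_baseChange_of_isUnit_two_three` (additive reduction is preserved — the
  ADDITIVE case of VII.5.4 (a); part 14 `hasAdditiveReduction_baseChange_of_isMinimal`);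
* §3 for `E/ℚ` at a prime `p ≥ 5`: `isUnit_two_padicInt_of_five_le`,
  `isUnit_three_padicInt_of_five_le`, **`isMinimal_baseChange_padic_of_five_le`**
  (`((W ⊗ ℚ_p) ⊗ L).IsMinimal R` for a globally minimal `W`, NO residual), and
  **`hasAdditiveReduction_baseChange_padic_of_five_le`** (`¬` good, `¬` multiplicative at
  `p ≥ 5 ⇒ ((W ⊗ ℚ_p) ⊗ L).HasAdditiveReduction R`, i.e. part 15's
  `hasAdditiveReduction_baseChange_padic_of_isMinimal` with R7′ DISCHARGED).

EFFECT on the interface: the statements of parts 14/15 and of `AdditivePlaceKummer` keep the binder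
`[((W ⊗ ℚ_p) ⊗ L).IsMinimal R]` (it types `E₀(L)`); whoever instantiates the layer discharges it
by `haveI := isMinimal_baseChange_padic_of_five_le W p L R hp hϖ hπ` at every additive `p ≥ 5`,
exactly as R7 is discharged at multiplicative places by part 3 / p8's
`isMinimal_baseChange_padic_self`. R7′ stays a LABELLED residual ONLY at additive places of residue
characteristic `2` or `3` (for `3 ∥ N`: `ℓ = 2`, i.e. `4 ∣ N`).

References (locators only; no new fact): [cite: SilvermanAEC2009, VII.1 Remark 1.1 (PDF p. 165)
and Prop. VII.5.4 (a) (PDF p. 175)] [cite: NeukirchANT1999, II (6.2) (valuations in unramified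
extensions)].

## Design

No definitions; `noncomputable section`; `open scoped Classical`; universe `u` for `F`, `L` as in
`JetchevKummerAtP`, `L : Type` in §3 (the universe of `ℚ_[p]`); `R₀`, `R` abstract discrete
valuation rings with `[IsLocalHom (algebraMap R₀ R)]`. Axioms: `propext`, `Classical.choice`,
`Quot.sound`.
-/

noncomputable section

open scoped Classical

namespace Summit.BirchSwinnertonDyer.Rank1Residual.X11b.Three.JetchevKummer

open WeierstrassCurve IsDiscreteValuationRing

universe u

/-! ### §1 An unramified local extension of discrete valuation rings preserves valuations -/

section Unramified

variable {F : Type u} [Field F] (L : Type u) [Field L] [Algebra F L]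
  (R₀ : Type*) [CommRing R₀] [IsDomain R₀] [IsDiscreteValuationRing R₀] [Algebra R₀ F]
  [IsFractionRing R₀ F]
  (R : Type*) [CommRing R] [IsDomain R] [IsDiscreteValuationRing R] [Algebra R L]
  [IsFractionRing R L]
  [Algebra R₀ R] [Algebra R₀ L] [IsScalarTower R₀ R L] [IsScalarTower R₀ F L]
  [IsLocalHom (algebraMap R₀ R)]

omit [IsDomain R] [IsDiscreteValuationRing R] in
/-- **A uniformiser of `R` lying in `F` is the image of a uniformiser of `R₀`.** If `ϖ` is a
uniformiser of `R` with `ϖ = ι π`, `π ∈ F`, then `π ∈ R₀` (`R ∩ F = R₀`, part 1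
`algebraMap_mem_range_iff`), and its preimage `π₀ ∈ R₀` is irreducible (a local homomorphism
reflects irreducibility, Mathlib `Irreducible.of_map`). Neukirch, *ANT* II (6.2). [folklore] -/
theorem exists_irreducible_algebraMap_eq {ϖ : R} (hϖ : Irreducible ϖ) {π : F}
    (hπ : algebraMap F L π = algebraMap R L ϖ) :
    ∃ π₀ : R₀, Irreducible π₀ ∧ algebraMap R₀ R π₀ = ϖ ∧ algebraMap R₀ F π₀ = π := by
  obtain ⟨π₀, hπ₀⟩ : π ∈ Set.range (algebraMap R₀ F) :=
    (algebraMap_mem_range_iff L R₀ R π).mp ⟨ϖ, hπ.symm⟩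
  have hι : algebraMap R₀ R π₀ = ϖ := by
    apply IsFractionRing.injective R L
    rw [← IsScalarTower.algebraMap_apply, IsScalarTower.algebraMap_apply R₀ F L, hπ₀, hπ]
  refine ⟨π₀, ?_, hι, hπ₀⟩
  rw [← hι] at hϖ
  exact Irreducible.of_map (f := algebraMap R₀ R) hϖ

/-- **`e (L/F) = 1`: the additive valuation of `R` restricts to that of `R₀`.** With a
uniformiser of `R` coming from `F`, `v_R (ι r) = v_{R₀} (r)` for every `r ∈ R₀`: write
`r = u · π₀ⁿ` with `u ∈ R₀ˣ`; then `ι r = ι(u) · ϖⁿ` with `ι(u) ∈ Rˣ`. Neukirch, *ANT* II (6.2).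
[folklore] -/
theorem addVal_algebraMap_eq {ϖ : R} (hϖ : Irreducible ϖ) {π : F}
    (hπ : algebraMap F L π = algebraMap R L ϖ) (r : R₀) :
    addVal R (algebraMap R₀ R r) = addVal R₀ r := by
  obtain ⟨π₀, hπ₀, hι, -⟩ := exists_irreducible_algebraMap_eq L R₀ R hϖ hπ
  by_cases hr : r = 0
  · rw [hr, map_zero]
    simp
  obtain ⟨n, u, rfl⟩ := eq_unit_mul_pow_irreducible hr hπ₀
  rw [map_mul, map_pow, hι, addVal_def' u hπ₀ n,
    show algebraMap R₀ R (u : R₀) = ((Units.map (algebraMap R₀ R : R₀ →* R) u : Rˣ) : R) from rfl,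
    addVal_def' _ hϖ n]

/-- **Membership in powers of the maximal ideal is unchanged in an unramified extension**:
`ι r ∈ 𝔪_Rⁿ ↔ r ∈ 𝔪_{R₀}ⁿ` for `r ∈ R₀` (`𝔪ⁿ = (ϖⁿ)`, divisibility read through `addVal`).
[folklore] -/
theorem algebraMap_mem_maximalIdeal_pow_iff {ϖ : R} (hϖ : Irreducible ϖ) {π : F}
    (hπ : algebraMap F L π = algebraMap R L ϖ) (r : R₀) (n : ℕ) :
    algebraMap R₀ R r ∈ IsLocalRing.maximalIdeal R ^ n ↔ r ∈ IsLocalRing.maximalIdeal R₀ ^ n := by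
  obtain ⟨π₀, hπ₀, hι, -⟩ := exists_irreducible_algebraMap_eq L R₀ R hϖ hπ
  rw [hϖ.maximalIdeal_eq, hπ₀.maximalIdeal_eq, Ideal.span_singleton_pow, Ideal.span_singleton_pow,
    Ideal.mem_span_singleton, Ideal.mem_span_singleton, ← addVal_le_iff_dvd, ← addVal_le_iff_dvd,
    addVal_pow, addVal_pow, addVal_uniformizer hϖ, addVal_uniformizer hπ₀,
    addVal_algebraMap_eq L R₀ R hϖ hπ]

end Unramified

/-! ### §2 *AEC* VII.5.4 (a) at residue characteristic `≠ 2, 3`: minimality and additive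
reduction are preserved under unramified base change -/

section Minimal

variable {F : Type u} [Field F] (X : WeierstrassCurve F) (L : Type u) [Field L] [Algebra F L]
  (R₀ : Type*) [CommRing R₀] [IsDomain R₀] [IsDiscreteValuationRing R₀] [Algebra R₀ F]
  [IsFractionRing R₀ F]
  (R : Type*) [CommRing R] [IsDomain R] [IsDiscreteValuationRing R] [Algebra R L]
  [IsFractionRing R L]
  [Algebra R₀ R] [Algebra R₀ L] [IsScalarTower R₀ R L] [IsScalarTower R₀ F L]
  [IsLocalHom (algebraMap R₀ R)]

/-- **Silverman, *AEC* Prop. VII.5.4 (a), residue characteristic `≠ 2, 3`: a minimal equation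
stays minimal over an unramified extension.** Let `R₀ → R` be a local homomorphism of discrete
valuation rings of `F ⊆ L` with a uniformiser of `R` coming from `F` (`e = 1`), and `2, 3 ∈ R₀ˣ`.
If `X ⊗ F` is `R₀`-minimal then `X ⊗ L` is `R`-minimal. Proof: for `Δ ≠ 0`, minimality over `R₀`
forbids `Δ ∈ 𝔪¹² ∧ c₄ ∈ 𝔪⁴` for the integral model (*AEC* VII.1 Remark 1.1, `only if` half, tree
`not_Δ_mem_pow_and_c₄_mem_pow_of_isMinimal`); the `R`-integral model of `X ⊗ L` is that model
mapped along `ι` (part 1 `integralModel_baseChange_eq_map`) and `ι r ∈ 𝔪_Rᵐ ↔ r ∈ 𝔪_{R₀}ᵐ`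
(§1), so the same holds over `R`, which is the `if` half (`isMinimal_of_not_Δ_mem_pow_and_c₄_mem_pow`,
valid in every residue characteristic). A singular equation (`Δ = 0`) is minimal in Mathlib's
sense as soon as it is integral. This DISCHARGES the residual binder R7′ `[(X ⊗ L).IsMinimal R]`
of parts 14/15 at every additive place of residue characteristic `≥ 5`.
[cite: SilvermanAEC2009, Prop. VII.5.4 (a) (PDF p. 175) and VII.1 Remark 1.1 (PDF p. 165)] -/
theorem isMinimal_baseChange_of_isUnit_two_three [(X.baseChange F).IsMinimal R₀]
    (h2 : IsUnit (2 : R₀)) (h3 : IsUnit (3 : R₀)) {ϖ : R} (hϖ : Irreducible ϖ) {π : F}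
    (hπ : algebraMap F L π = algebraMap R L ϖ) : (X.baseChange L).IsMinimal R := by
  haveI hint : (X.baseChange L).IsIntegral R := isIntegral_baseChange_of_isIntegral X L R₀ R
  by_cases hΔ : (X.baseChange F).Δ = 0
  · -- singular equation: every integral model is minimal
    have hΔL : (X.baseChange L).Δ = 0 := by
      have h0 : X.Δ = 0 := by
        rw [WeierstrassCurve.baseChange, map_Δ, Algebra.algebraMap_self, RingHom.id_apply] at hΔ
        exact hΔ
      rw [WeierstrassCurve.baseChange, map_Δ, h0, map_zero]
    refine ⟨⟨by simpa using hint, fun C hC _ ↦ ?_⟩⟩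
    haveI : (C • X.baseChange L).IsIntegral R := hC
    rw [← Subtype.coe_le_coe, valuation_Δ_aux_eq_of_isIntegral, variableChange_Δ, hΔL, mul_zero,
      map_zero]
    exact zero_le
  · have key := not_Δ_mem_pow_and_c₄_mem_pow_of_isMinimal R₀ h2 h3 (X.baseChange F) hΔ
    refine isMinimal_of_not_Δ_mem_pow_and_c₄_mem_pow R (X.baseChange L) ?_
    rw [integralModel_baseChange_eq_map X L R₀ R, map_Δ, map_c₄,
      algebraMap_mem_maximalIdeal_pow_iff L R₀ R hϖ hπ,
      algebraMap_mem_maximalIdeal_pow_iff L R₀ R hϖ hπ]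
    exact key

/-- **Silverman, *AEC* Prop. VII.5.4 (a), the ADDITIVE case at residue characteristic `≠ 2, 3`:
additive reduction is preserved under unramified base change.** With `R₀ → R` local, `e = 1` and
`2, 3 ∈ R₀ˣ`: `(X ⊗ F).HasAdditiveReduction R₀ → (X ⊗ L).HasAdditiveReduction R` (minimality by
`isMinimal_baseChange_of_isUnit_two_three`; `v(Δ) > 0`, `v(c₄) > 0` by part 14
`hasAdditiveReduction_baseChange_of_isMinimal`).
[cite: SilvermanAEC2009, Prop. VII.5.4 (a) (PDF p. 175)] -/
theorem hasAdditiveReduction_baseChange_of_isUnit_two_three [(X.baseChange F).HasAdditiveReduction R₀]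
    (h2 : IsUnit (2 : R₀)) (h3 : IsUnit (3 : R₀)) {ϖ : R} (hϖ : Irreducible ϖ) {π : F}
    (hπ : algebraMap F L π = algebraMap R L ϖ) : (X.baseChange L).HasAdditiveReduction R := by
  haveI := isMinimal_baseChange_of_isUnit_two_three X L R₀ R h2 h3 hϖ hπ
  exact hasAdditiveReduction_baseChange_of_isMinimal X L R₀ R

end Minimal

/-! ### §3 `E/ℚ` at a prime `p ≥ 5`: R7′ discharged -/

section Padic

variable (W : WeierstrassCurve ℚ) [W.IsElliptic] [W.IsGloballyMinimal] (p : ℕ) [Fact p.Prime]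
  (L : Type) [Field L] [Algebra ℚ_[p] L]
  (R : Type*) [CommRing R] [IsDomain R] [IsDiscreteValuationRing R] [Algebra R L]
  [IsFractionRing R L] [Algebra ℤ_[p] R] [Algebra ℤ_[p] L] [IsScalarTower ℤ_[p] R L]
  [IsScalarTower ℤ_[p] ℚ_[p] L] [IsLocalHom (algebraMap ℤ_[p] R)]

omit [Fact p.Prime] in
/-- `2 ∈ ℤ_pˣ` for `p ≥ 5` (indeed for `p ≠ 2`). [folklore] -/
theorem isUnit_two_padicInt_of_five_le [Fact p.Prime] (hp : 5 ≤ p) : IsUnit (2 : ℤ_[p]) :=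
  isUnit_two_padicInt (by omega)

omit [Fact p.Prime] in
/-- `3 ∈ ℤ_pˣ` for `p ≥ 5` (`p` and `3` are distinct primes). [folklore] -/
theorem isUnit_three_padicInt_of_five_le [Fact p.Prime] (hp : 5 ≤ p) : IsUnit (3 : ℤ_[p]) := by
  rw [PadicInt.isUnit_iff, show (3 : ℤ_[p]) = ((3 : ℕ) : ℤ_[p]) by norm_cast,
    PadicInt.norm_natCast_eq_one_iff]
  exact (Nat.coprime_primes Fact.out Nat.prime_three).mpr (by omega)

omit [W.IsElliptic] in
/-- **R7′ DISCHARGED at `p ≥ 5`: the global minimal equation stays minimal over every unramified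
layer `L ⊇ ℚ_p`.** For `W/ℚ` globally minimal, `p ≥ 5`, `R` the valuation ring of `L` with
`ℤ_p → R` local and a uniformiser of `R` coming from `ℚ_p` (binder R5: `hπ : π = ι ϖ`):
`(W ⊗ ℚ_p) ⊗ L` is `R`-minimal — *AEC* VII.5.4 (a) (`isMinimal_baseChange_of_isUnit_two_three`
with `2, 3 ∈ ℤ_pˣ` and p8's `isMinimal_baseChange_padic_self`). Use:
`haveI := isMinimal_baseChange_padic_of_five_le W p L R hp hϖ hπ` before any statement of parts
14/15 or `AdditivePlaceKummer` carrying `[((W ⊗ ℚ_p) ⊗ L).IsMinimal R]`.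
[cite: SilvermanAEC2009, Prop. VII.5.4 (a) (PDF p. 175), VIII.8] -/
theorem isMinimal_baseChange_padic_of_five_le (hp : 5 ≤ p) {ϖ : R} (hϖ : Irreducible ϖ)
    {π : ℚ_[p]} (hπ : algebraMap ℚ_[p] L π = algebraMap R L ϖ) :
    ((W.baseChange ℚ_[p]).baseChange L).IsMinimal R := by
  haveI := isMinimal_baseChange_padic_self W p
  exact isMinimal_baseChange_of_isUnit_two_three (W.baseChange ℚ_[p]) L ℤ_[p] R
    (isUnit_two_padicInt_of_five_le p hp) (isUnit_three_padicInt_of_five_le p hp) hϖ hπ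

/-- **Additive reduction at a prime `p ≥ 5` over every unramified layer, NO residual**: if `W/ℚ`
(globally minimal) has neither good nor multiplicative reduction at `p ≥ 5`, then `(W ⊗ ℚ_p) ⊗ L`
has ADDITIVE reduction over `R` for every `L ⊇ ℚ_p` with `ℤ_p → R` local and `e = 1` — part 15's
`hasAdditiveReduction_baseChange_padic_of_isMinimal` with its instance hypothesis R7′ discharged by
`isMinimal_baseChange_padic_of_five_le`. [cite: SilvermanAEC2009, Prop. VII.5.4 (a) (PDF p. 175)] -/
theorem hasAdditiveReduction_baseChange_padic_of_five_le (hp : 5 ≤ p)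
    (hg : ¬ W.HasGoodReductionAtPrime p) (hm : ¬ W.HasMultiplicativeReductionAtPrime p)
    {ϖ : R} (hϖ : Irreducible ϖ) {π : ℚ_[p]} (hπ : algebraMap ℚ_[p] L π = algebraMap R L ϖ) :
    ((W.baseChange ℚ_[p]).baseChange L).HasAdditiveReduction R := by
  haveI := isMinimal_baseChange_padic_of_five_le W p L R hp hϖ hπ
  exact hasAdditiveReduction_baseChange_padic_of_isMinimal W p L R hg hm

end Padic

end Summit.BirchSwinnertonDyer.Rank1Residual.X11b.Three.JetchevKummer

end
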